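import Summits.ValiantsHypothesis.ValiantsHypothesis.Theses.BorderApolarity

/-!
# Route BorderApolarity — Assembly

Closes item stmt-ValiantsHypothesis-5783 (`Assembly`) of route
`route-ValiantsHypothesis-BorderApolarity`: the pure-logic composition

  `FixedWitnessObstructionQP → BorelFixedBorderApolarity → GctBridge → ValiantsHypothesis`.

Given `c`, take `n₀' := max (n₀ c) 3`; for `n ≥ n₀'` and `n ≤ m ≤ 2 ^ ((log₂ n + c) ^ c)`,
membership of the padded permanent in `Δ(det_m)` yields a Borel-fixed border-apolar witness by
`BorelFixedBorderApolarity n m` (needs `3 ≤ n`, `n ≤ m`), contradicting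
`FixedWitnessObstructionQP c`; the resulting quasi-polynomial non-membership statement is exactly
the hypothesis of `GctBridge`, which returns `ValiantsHypothesis`.
-/

namespace Summit.ValiantsHypothesis.BorderApolarity

open Summit.ValiantsHypothesis.ValiantsHypothesis.Theses.BorderApolarity

/-- The assembly of route BorderApolarity: the crux `FixedWitnessObstructionQP`, the support
`BorelFixedBorderApolarity` and the bridge `GctBridge` together give `ValiantsHypothesis`
(pure logic; closes item stmt-ValiantsHypothesis-5783). -/
theorem assembly_proof :
    Summit.ValiantsHypothesis.ValiantsHypothesis.Theses.BorderApolarity.Assembly := by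
  unfold Assembly
  intro hFWO hBFBA hBridge
  apply hBridge
  intro c
  obtain ⟨n₀, hn₀⟩ := hFWO c
  refine ⟨max n₀ 3, ?_⟩
  intro n hn m inst hnm hm hmem
  have h3n : 3 ≤ n := le_trans (le_max_right n₀ 3) hn
  have hn' : n ≥ n₀ := le_trans (le_max_left n₀ 3) hn
  exact (@hn₀ n hn' m inst hnm hm) (@hBFBA n m inst h3n hnm hmem)

end Summit.ValiantsHypothesis.BorderApolarity
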